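import Summits.CriticalPhenomena.Ising3DConformalLimit.Theses.PerfectScreening
import Summits.CriticalPhenomena.Ising3DConformalLimit.Theses.AnomalousForcesInteraction
import Summits.CriticalPhenomena.Ising3DConformalLimit.Theses.IsingEuclidUpgrade
import Summits.CriticalPhenomena.Ising3DConformalLimit.Theorems.GaussianLimitNotScreened.Negative.Reformulation
import Summits.CriticalPhenomena.Ising3DConformalLimit.Theorems.PerfectScreeningGaussianLimitNotScreenedHalfOneReduction
import HarnessLib

/-!
# Crux `GaussianLimitNotScreened` (stmt-CriticalPhenomena-13886): items-level wiring (lead c3)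

THEOREM-ONLY file (line lead prover-line-stmt-CriticalPhenomena-13886-c3-0, 2026-08-16). After four lead seats every
provable stub of the three planned lines is a tree theorem and what is left of the crux is exactly its two halves
(`GaussianLimitNotScreenedNegative.crux_iff_half_and_amplitude`): half (I) "every non-degenerate Möbius-covariant
pointwise scaling limit of `criticalCorr 3` with `U₄ ≡ 0` has `Δ = 1/2`" and half (II) "at `Δ = 1/2` the renormalisation
is canonical along a subsequence, `ρ(1/m)²/m ↛ ∞`". This file records, kernel-checked and BY NAME, how the crux sits
among the EXISTING items of the sub-problem — the data the route's kill criterion (d) asks for: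

* `gaussianLimitNotScreened_of_r4NonGaussian` — the crux is implied outright (by vacuity) by item
  stmt-CriticalPhenomena-0636 `IsingEuclidUpgrade.IsingEuclidUpgradeR4NonGaussian` (non-triviality of every
  non-degenerate pointwise limit);
* `halfOne_of_gaussianLimitIsFree` — half (I) is item stmt-CriticalPhenomena-2601
  `AnomalousForcesInteraction.GaussianLimitIsFree` restricted to Möbius-covariant limits (Möbius ⇒ translation
  invariant + scale covariant), verbatim;
* `stub_cruxOfFreeAndAmplitude` (registered bookkeeping statement of the crux) — crux ⟸ item 2601 ∧ half (II), where
  half (II) is the registered open stub D `stub_amplitudeAtHalf` of line single-layer-linear-regression verbatim;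
* `gaussianLimitNotScreened_of_gaussianLimitIsFree_of_isingCapacityAxial` — crux ⟸ item 2601 ∧ crux
  stmt-CriticalPhenomena-13885's registered open stub `stub_isingCapacityAxial` (through the landed
  `amplitudeAtHalf_of_isingCapacityAxial'`);
* `halfOne_and_amplitude_of_crux` — conversely the crux implies both halves (the landed equivalence, restated in the
  coordinates used here), so on Möbius limits the crux is EXACTLY (2601 ∧ D).

No new mathematics: pure logic over landed theorems. References: C. M. Newman, Commun. Math. Phys. 41 (1975);
M. Aizenman, Commun. Math. Phys. 86 (1982).
-/

noncomputable section

namespace Summit.CriticalPhenomena.Ising3DConformalLimit.Cruxes.GaussianLimitNotScreened.SingleLayerLinearRegression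

open MeasureTheory Filter Topology
open Literature.Probability.LatticeModels
open Summit.CriticalPhenomena.Ising3DConformalLimit.GaussianLimitNotScreenedNegative (screened_iff_renorm
  crux_iff_half_and_amplitude)

/-- **The crux by vacuity from item stmt-CriticalPhenomena-0636** (`IsingEuclidUpgradeR4NonGaussian`: every
non-degenerate pointwise scaling limit of `criticalCorr 3` has `U₄ ≢ 0`): then the hypotheses of the crux are
contradictory. So r4 of route PerfectScreening is dominated by the non-triviality crux of route IsingEuclidUpgrade.
[cite: Aizenman1982, §1] -/
theorem gaussianLimitNotScreened_of_r4NonGaussian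
    (h : Summit.CriticalPhenomena.Ising3DConformalLimit.Theses.IsingEuclidUpgrade.IsingEuclidUpgradeR4NonGaussian) :
    Summit.CriticalPhenomena.Ising3DConformalLimit.Theses.PerfectScreening.GaussianLimitNotScreened := by
  intro ρ Δ S hρ hlim hnd _ hU4 _
  exact hU4 (h ρ S hρ hlim hnd)

/-- **Half (I) is item stmt-CriticalPhenomena-2601 on Möbius limits**: `GaussianLimitIsFree` (a Gaussian
translation-invariant scale-covariant non-degenerate pointwise limit of `criticalCorr 3` has `Δ = 1/2`) gives half (I)
verbatim, since Möbius covariance contains translation invariance and scale covariance. [cite: Kotani1973, Theorem 2] -/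
theorem halfOne_of_gaussianLimitIsFree
    (hfree : Summit.CriticalPhenomena.Ising3DConformalLimit.Theses.AnomalousForcesInteraction.GaussianLimitIsFree) :
    ∀ (ρ : ℝ → ℝ) (Δ : ℝ) (S : CorrFamily 3), (∀ δ ∈ Set.Ioc (0:ℝ) 1, 0 < ρ δ) →
      HasPointwiseScalingLimit (criticalCorr 3) ρ S → IsNondegenerateTwoPoint S →
      IsMoebiusCovariant Δ S → ¬ HasNontrivialU4 S → Δ = 1 / 2 :=
  fun ρ Δ S hρ hlim hnd hMo hU4 =>
    hfree ρ Δ S hρ hlim hnd hMo.isEuclideanInvariant.1 hMo.isScaleCovariant hU4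

/-- **The crux from item stmt-CriticalPhenomena-2601 and half (II)** (registered bookkeeping statement
`stub_cruxOfFreeAndAmplitude` of the crux): `GaussianLimitIsFree` settles half (I) (`halfOne_of_gaussianLimitIsFree`),
so `Δ = 1/2`; perfect screening then forces `ρ(1/m)²/m → ∞` (landed `screened_iff_renorm`), which half (II) — the
registered open stub D `stub_amplitudeAtHalf` of line single-layer-linear-regression, taken verbatim as the second
hypothesis — forbids. Conditional on both hypotheses (item 2601 is open; D is open). [cite: Newman1975Gaussian, Theorem 3] -/
theorem stub_cruxOfFreeAndAmplitude :
    Summit.CriticalPhenomena.Ising3DConformalLimit.Theses.AnomalousForcesInteraction.GaussianLimitIsFree →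
    (∀ (ρ : ℝ → ℝ) (S : CorrFamily 3), (∀ δ ∈ Set.Ioc (0:ℝ) 1, 0 < ρ δ) →
      HasPointwiseScalingLimit (criticalCorr 3) ρ S → IsNondegenerateTwoPoint S →
      IsMoebiusCovariant (1/2) S → ¬ HasNontrivialU4 S →
      ¬ Tendsto (fun m : ℕ => ρ (1 / m) ^ 2 / m) atTop atTop) →
    Summit.CriticalPhenomena.Ising3DConformalLimit.Theses.PerfectScreening.GaussianLimitNotScreened := by
  intro hfree hD ρ Δ S hρ hlim hnd hMo hU4 hscr
  have hΔ : Δ = 1 / 2 := halfOne_of_gaussianLimitIsFree hfree ρ Δ S hρ hlim hnd hMo hU4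
  subst hΔ
  exact hD ρ S hρ hlim hnd hMo hU4 ((screened_iff_renorm hlim hnd).1 hscr)

section Axial

open Summit.CriticalPhenomena.Ising3DConformalLimit.Cruxes.IsingEuclidUpgradeR4NonGaussian.FreeCovarianceDeltaDichotomy
  (boxG)
open Summit.CriticalPhenomena.Ising3DConformalLimit.Cruxes.GaussianLimitNotScreened.KaramataAmplitudeBlindMerging
  (IsSpreadDefect defectG)

/-- **The crux from item stmt-CriticalPhenomena-2601 and crux stmt-CriticalPhenomena-13885's registered open stub
`stub_isingCapacityAxial`** (axial Ising capacity at one exponent `s < 2`, written out verbatim as the second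
hypothesis): the latter gives half (II) by the landed `amplitudeAtHalf_of_isingCapacityAxial'` (Aizenman's criterion
at the axial quadruple). So the crux hangs on two NAMED open statements that already live elsewhere on the ledger.
[cite: Aizenman1982, §1] -/
theorem gaussianLimitNotScreened_of_gaussianLimitIsFree_of_isingCapacityAxial
    (hfree : Summit.CriticalPhenomena.Ising3DConformalLimit.Theses.AnomalousForcesInteraction.GaussianLimitIsFree)
    (hcap : ∃ s : ℝ, 0 < s ∧ s < 2 ∧ ∀ K lam nu : ℝ, 0 < K → 0 < lam → 0 < nu →
      ∃ c' : ℝ, 0 < c' ∧ c' ≤ 1 ∧ ∃ R₀ : ℝ, ∀ c e : Site 3, (∀ j : Fin 3, j ≠ 0 → e j = c j) →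
        R₀ ≤ ‖c - e‖ → ∀ᶠ L : ℕ in atTop, ∀ C : Finset (Site 3), c ∉ C → e ∉ C →
          IsSpreadDefect s K lam nu c e C → defectG L C c e ≤ (1 - c') * boxG L c e) :
    Summit.CriticalPhenomena.Ising3DConformalLimit.Theses.PerfectScreening.GaussianLimitNotScreened :=
  stub_cruxOfFreeAndAmplitude hfree (amplitudeAtHalf_of_isingCapacityAxial' hcap)

end Axial

/-- **Conversely, the crux implies both halves** (the landed `crux_iff_half_and_amplitude`, read left to right and
restated in this file's coordinates): half (I) for every `Δ`, and half (II) at `Δ = 1/2`. Together with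
`stub_cruxOfFreeAndAmplitude`: on Möbius-covariant limits the crux is exactly (item 2601's conclusion) ∧ (stub D).
[cite: Newman1975Gaussian, Theorem 3] -/
theorem halfOne_and_amplitude_of_crux
    (h : Summit.CriticalPhenomena.Ising3DConformalLimit.Theses.PerfectScreening.GaussianLimitNotScreened) :
    (∀ (ρ : ℝ → ℝ) (Δ : ℝ) (S : CorrFamily 3), (∀ δ ∈ Set.Ioc (0:ℝ) 1, 0 < ρ δ) →
      HasPointwiseScalingLimit (criticalCorr 3) ρ S → IsNondegenerateTwoPoint S →
      IsMoebiusCovariant Δ S → ¬ HasNontrivialU4 S → Δ = 1 / 2) ∧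
    (∀ (ρ : ℝ → ℝ) (S : CorrFamily 3), (∀ δ ∈ Set.Ioc (0:ℝ) 1, 0 < ρ δ) →
      HasPointwiseScalingLimit (criticalCorr 3) ρ S → IsNondegenerateTwoPoint S →
      IsMoebiusCovariant (1/2) S → ¬ HasNontrivialU4 S →
      ¬ Tendsto (fun m : ℕ => ρ (1 / m) ^ 2 / m) atTop atTop) := by
  have h' := crux_iff_half_and_amplitude.1 h
  exact ⟨fun ρ Δ S hρ hlim hnd hMo hU4 => (h' ρ Δ S hρ hlim hnd hMo hU4).1,
    fun ρ S hρ hlim hnd hMo hU4 => (h' ρ (1/2) S hρ hlim hnd hMo hU4).2⟩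

end Summit.CriticalPhenomena.Ising3DConformalLimit.Cruxes.GaussianLimitNotScreened.SingleLayerLinearRegression

end
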